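import Mathlib.RingTheory.Polynomial.Basic
import Mathlib.RingTheory.Adjoin.Polynomial.Basic
import Mathlib.Algebra.Polynomial.RingDivision
import Mathlib.LinearAlgebra.Dual.Lemmas
import Mathlib.RepresentationTheory.Irreducible
import Literature.NumberTheory.Automorphic.GKModulesOneParameter
import HarnessLib

/-!
# A `(𝔤, K)`-module on which an element of the `𝔨`-algebra acts diagonalisably with finite-dimensional
# eigenspaces is admissible

Topic `NumberTheory/Automorphic`; namespace `Literature.NumberTheory.Automorphic.IsGKModule` (companion to `GKModules`,
`GKModulesOneParameter`, `GKModulesAdCompatOfWeakDeriv`).  Theorems only: no definition, no named fact, no `sorry`.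

Let `(ρK, ρ𝔤)` be a `(𝔤, K)`-module of a real matrix group `G` (the tree's `IsGKModule G ρK ρ𝔤`: `K`-finite, weakly
continuous, weak derivative `d/dt|₀ ℓ (ρK (exp tY) v) = ℓ (ρ𝔤 Y v)` along `𝔨`, `Ad`-compatible) and let `𝒜 ⊆ End_ℂ V` be the
(associative, unital) subalgebra generated by `ρ𝔤(𝔨)`.  This file proves the ADMISSIBILITY CRITERION

> if some `T ∈ 𝒜` is diagonalisable on `V` with finite-dimensional eigenspaces (every vector is a finite sum of
> `T`-eigenvectors, and every eigenspace `ker (T − c)` is finite-dimensional), then `ρK` is admissible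
> (`IsAdmissibleGK ρK`: every irreducible finite-dimensional `K`-type has finite multiplicity `dim Hom_K(τ, V) < ∞`),

valid for EVERY `K`-action `ρK` compatible with `ρ𝔤` in the `(𝔤, K)`-sense — the form in which the admissibility of an
explicitly given `𝔤`-module with known `𝔨`-weights (e.g. Kovačević's `K`-type data for `SU(2,1)`, where `Z = H_α + 2H_β ∈ 𝔨` acts
on the `K`-type `V_{n,m}` by `m` and the ladder modules have one `K`-type per value of `m`) is transported to the analytic
`(𝔤, K)`-category.  This is the standard remark that admissibility is a property of the `𝔨`-module of `K`-finite vectors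
(Knapp–Vogan §I.3 before Prop. 1.63: "each `K` type has finite multiplicity"; Borel–Wallach 0 §2.4; Wallach §3.3.1), made
quantitative through ONE diagonalisable element.

* §1 `apply_mem_of_K_stable_of_mem_adjoin` — a `K`-stable subspace is stable under the whole `𝔨`-algebra `𝒜`
  (generators: the tree's `IsGKModule.apply_mem_of_expK_stable`).
* §2 **`IntertwiningMap.apply_eq_of_apply_eq_of_mem_adjoin`** — the TRANSPORT LEMMA: for `K`-maps `j₀, j : W → V` out of one
  `K`-module `τ` with `j₀` injective and `T ∈ 𝒜`, `j₀ w' = T (j₀ w) ⟹ j w' = T (j w)` ("all copies of `τ` in `V` carry the same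
  `𝒜`-action"); for a generator `T = ρ𝔤 Y` this is the uniqueness of the weak derivative of the matrix coefficient
  `t ↦ ℓ (ρK (exp tY) (j w)) = ℓ' (ρK (exp tY) (j₀ w))`, `ℓ'` a functional extending `ℓ ∘ j ∘ j₀⁻¹` from `j₀(W)`
  (`Subspace.dualLift`), and functionals separate points; sums, products and scalars by induction over `𝒜`.
* §3 `ker_aeval_prod_X_sub_C_le` — `ker ∏_{c ∈ s} (T − c) ≤ ⨆_{c ∈ s} ker (T − c)` (coprime factors,
  Mathlib `Polynomial.sup_ker_aeval_eq_ker_aeval_mul_of_coprime`), and the vanishing of `∏_{c ∈ s} (T − c)` on that sum.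
* §4 **`isAdmissibleGK_of_mem_adjoin_of_eigenspaces`** (the criterion) and **`isAdmissibleGK_of_eigenspaces`** (the case
  `T = ρ𝔤 Z`, `Z ∈ 𝔨`): for an irreducible `K`-type `τ` either `Hom_K(τ, V) = 0`, or some `j₀ ≠ 0` is injective
  (Mathlib `Representation.IsIrreducible.injective_or_eq_zero`), `j₀(W) ⊆ E := ⨆_{c ∈ C₀} ker (T − c)` for a finite set `C₀`
  of eigenvalues, `p(T) := ∏_{c ∈ C₀} (T − c)` kills `j₀(W)`, hence by §2 (with `w' = 0`) kills every `j(W)`, so every `K`-map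
  lands in the finite-dimensional `E` (§3) and `Hom_K(τ, V) ↪ Hom_ℂ(W, E)` is finite-dimensional.
* §5 `isAdmissibleGK_of_basis_eigenvector` — the same with the diagonalisation given by an eigenbasis `T (b i) = c i • b i`
  whose fibres `{i | c i = c₀}` are finite (the shape of explicit `K`-type data).

## Mathlib / Literature search

Tree: `IsGKModule`, `IsAdmissibleGK` (`GKModules`), `IsGKModule.apply_mem_of_expK_stable` (`GKModulesOneParameter`),
`isAdmissibleGK_of_isKAdmissible` / `isKAdmissible_iff_forall_irreducible_finite_isotypicSum` (`BorelWallach2000/AdmissibleIrreducibleCriterion`,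
not needed: we prove the Knapp–Vogan form directly), `U11IrreducibleModules.isAdmissibleGK_of_isIrreducibleGK` (the `U(1,1)` case, where
`K` is commutative and `K`-types are characters — the argument there does not extend to non-abelian `K`).  Mathlib:
`Representation.IntertwiningMap`, `Representation.IsIrreducible.injective_or_eq_zero`, `Subspace.dualLift`,
`Module.forall_dual_apply_eq_zero_iff`, `HasDerivAt.unique`, `Algebra.adjoin_induction`, `Polynomial.aeval_mem_adjoin_singleton`,
`Polynomial.sup_ker_aeval_eq_ker_aeval_mul_of_coprime`, `Polynomial.pairwise_coprime_X_sub_C`, `Module.End.eigenspace`.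
Dedup: `lean search 'isAdmissibleGK_of'` — only the finite-dimensional, equivalence-transport, `U(1,1)` and `GL_n`-cuspidal
instances; nothing for a general `(𝔤, K)`-module from `𝔨`-weight data.

## References

* A. W. Knapp, D. A. Vogan, *Cohomological Induction and Unitary Representations*, Princeton (1995), §I.3 (before Prop. 1.63),
  §I.4 (1.64)–(1.65). [KnappVogan1995]
* A. Borel, N. Wallach, *Continuous cohomology, discrete subgroups, and representations of reductive groups*, 2nd ed., AMS
  (2000), 0 §2.4–2.5. [BorelWallach2000]
* N. R. Wallach, *Real Reductive Groups I*, Academic Press (1988), §3.3.1. [WallachRRG1]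
-/

-- Mathlib idiom (commutator bracket on `Module.End`, `Mathlib/Algebra/Lie/OfAssociative.lean`), as in `GKModules`,
-- `GKModulesOneParameter`, `GKModulesAdCompatOfWeakDeriv` (the tree's established idiom; needed to state `ρ𝔤 : 𝔤 →ₗ⁅ℝ⁆ End V`)
attribute [local instance 100] LieRing.ofAssociativeRing

open scoped MatrixGroups Matrix
open Module Polynomial

noncomputable section

namespace Literature.NumberTheory.Automorphic

variable {A : Type*} [NormedCommRing A] [NormedAlgebra ℝ A] [NormedAlgebra ℚ A] [CompleteSpace A]
  [StarRing A] [StarModule ℝ A] [ContinuousStar A] {N : Type*} [Fintype N] [DecidableEq N]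
  {G : RealMatrixGroup A N}
  {V : Type*} [AddCommGroup V] [Module ℂ V]
  {ρK : Representation ℂ G.maximalCompact V} {ρ𝔤 : G.lie →ₗ⁅ℝ⁆ Module.End ℂ V}

namespace IsGKModule

/-! ## §1 `K`-stable subspaces are stable under the algebra generated by `ρ𝔤(𝔨)` -/

/-- **A `K`-stable subspace is stable under every element of the subalgebra of `End V` generated by `ρ𝔤(𝔨)`** (the
generators `ρ𝔤 Y`, `Y ∈ 𝔨`, preserve it by the weak-derivative argument `IsGKModule.apply_mem_of_expK_stable`; scalars, sums
and products trivially). [cite: BorelWallach2000, 0 §2.5] [cite: KnappVogan1995, §I.4 (1.64)–(1.65)] -/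
theorem apply_mem_of_K_stable_of_mem_adjoin (h : IsGKModule G ρK ρ𝔤) {U : Submodule ℂ V}
    (hU : ∀ (k : G.maximalCompact), ∀ u ∈ U, ρK k u ∈ U) {T : Module.End ℂ V}
    (hT : T ∈ Algebra.adjoin ℂ (Set.range fun Y : G.compactLie => ρ𝔤 (LieSubalgebra.inclusion G.compactLie_le_lie Y)))
    {u : V} (hu : u ∈ U) : T u ∈ U := by
  induction hT using Algebra.adjoin_induction generalizing u with
  | mem T hT =>
    obtain ⟨Y, rfl⟩ := hT
    exact h.apply_mem_of_expK_stable Y (fun t u hu => hU _ u hu) hu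
  | algebraMap r =>
    rw [Algebra.algebraMap_eq_smul_one, LinearMap.smul_apply, Module.End.one_apply]
    exact U.smul_mem r hu
  | add S T _ _ hS hT =>
    rw [LinearMap.add_apply]
    exact U.add_mem (hS hu) (hT hu)
  | mul S T _ _ hS hT =>
    rw [Module.End.mul_apply]
    exact hS (hT hu)

/-! ## §2 The transport lemma: all copies of a `K`-type carry the same action of the `𝔨`-algebra -/

section Transport

variable {W : Type*} [AddCommGroup W] [Module ℂ W] {τ : Representation ℂ G.maximalCompact W}

omit [StarModule ℝ A] [ContinuousStar A] in
/-- The image of a `K`-map is `K`-stable. [cite: KnappVogan1995, §I.3 (before Prop. 1.63)] -/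
theorem range_K_stable (j : τ.IntertwiningMap ρK) (k : G.maximalCompact) :
    ∀ u ∈ LinearMap.range j.toLinearMap, ρK k u ∈ LinearMap.range j.toLinearMap := by
  rintro _ ⟨w, rfl⟩
  exact ⟨τ k w, Representation.IntertwiningMap.isIntertwining _ _ j k w⟩

/-- **Transport lemma, generator case.**  Let `j₀, j : W → V` be `K`-maps out of a `K`-module `τ`, `j₀` injective, and
`Y ∈ 𝔨`.  If `j₀ w' = ρ𝔤 Y (j₀ w)` then `j w' = ρ𝔤 Y (j w)`: for every functional `ℓ` on `V`, with `ℓ'` an extension of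
`ℓ ∘ j ∘ j₀⁻¹` from `j₀(W)`, the matrix coefficients `t ↦ ℓ' (ρK (exp tY) (j₀ w))` and `t ↦ ℓ (ρK (exp tY) (j w))` COINCIDE
(both equal `ℓ (j (τ (exp tY) w))`), so their weak derivatives at `0` — `ℓ' (ρ𝔤 Y (j₀ w)) = ℓ' (j₀ w') = ℓ (j w')` and
`ℓ (ρ𝔤 Y (j w))` — agree, and functionals separate points. [cite: KnappVogan1995, §I.4 (1.64)–(1.65)] [cite: BorelWallach2000, 0 §2.5] -/
theorem IntertwiningMap.apply_eq_of_apply_eq_lie (h : IsGKModule G ρK ρ𝔤) (j₀ j : τ.IntertwiningMap ρK)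
    (hj₀ : Function.Injective j₀) (Y : G.compactLie) {w w' : W}
    (hw : j₀ w' = ρ𝔤 (LieSubalgebra.inclusion G.compactLie_le_lie Y) (j₀ w)) :
    j w' = ρ𝔤 (LieSubalgebra.inclusion G.compactLie_le_lie Y) (j w) := by
  rw [← sub_eq_zero, ← Module.forall_dual_apply_eq_zero_iff ℂ]
  intro ℓ
  -- `ℓ'` extends `ℓ ∘ j ∘ j₀⁻¹` from the subspace `j₀(W)`
  have hj₀' : Function.Injective j₀.toLinearMap := hj₀
  let e : W ≃ₗ[ℂ] LinearMap.range j₀.toLinearMap := LinearEquiv.ofInjective j₀.toLinearMap hj₀'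
  let ℓ' : Module.Dual ℂ V :=
    Subspace.dualLift (LinearMap.range j₀.toLinearMap) (ℓ ∘ₗ j.toLinearMap ∘ₗ e.symm.toLinearMap)
  have hℓ' : ∀ x : W, ℓ' (j₀ x) = ℓ (j x) := fun x => by
    have hx : j₀ x ∈ LinearMap.range j₀.toLinearMap := LinearMap.mem_range_self _ x
    have he : e.symm ⟨j₀ x, hx⟩ = x := by
      rw [show (⟨j₀ x, hx⟩ : LinearMap.range j₀.toLinearMap) = e x from Subtype.ext rfl, e.symm_apply_apply]
    show Subspace.dualLift (LinearMap.range j₀.toLinearMap) (ℓ ∘ₗ j.toLinearMap ∘ₗ e.symm.toLinearMap) (j₀ x) =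
      ℓ (j x)
    rw [Subspace.dualLift_of_mem hx, LinearMap.comp_apply, LinearMap.comp_apply, LinearEquiv.coe_coe, he]
    rfl
  -- the two matrix coefficients coincide
  have hcoeff : (fun t : ℝ => ℓ' (ρK (G.expK (t • Y)) (j₀ w))) = fun t : ℝ => ℓ (ρK (G.expK (t • Y)) (j w)) := by
    funext t
    rw [← j₀.isIntertwining, hℓ', j.isIntertwining]
  have h₁ := h.hasWeakDeriv Y (j₀ w) ℓ'
  rw [hcoeff] at h₁
  have h₂ := h.hasWeakDeriv Y (j w) ℓ
  have heq : ℓ' (ρ𝔤 (LieSubalgebra.inclusion G.compactLie_le_lie Y) (j₀ w)) =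
      ℓ (ρ𝔤 (LieSubalgebra.inclusion G.compactLie_le_lie Y) (j w)) := h₁.unique h₂
  rw [← hw, hℓ'] at heq
  rw [map_sub, heq, sub_self]

/-- **Transport lemma.**  Let `j₀, j : W → V` be `K`-maps out of a `K`-module `τ` with `j₀` injective, and `T` in the
subalgebra of `End V` generated by `ρ𝔤(𝔨)`.  Then `j₀ w' = T (j₀ w)` implies `j w' = T (j w)` — all copies of `τ` inside a
`(𝔤, K)`-module carry the same action of the `𝔨`-algebra (induction over the algebra from the generator case
`apply_eq_of_apply_eq_lie`, using that `j₀(W)` is `T`-stable, §1). [cite: KnappVogan1995, §I.4 (1.64)–(1.65)] [cite: BorelWallach2000, 0 §2.5] -/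
theorem IntertwiningMap.apply_eq_of_apply_eq_of_mem_adjoin (h : IsGKModule G ρK ρ𝔤) (j₀ j : τ.IntertwiningMap ρK)
    (hj₀ : Function.Injective j₀) {T : Module.End ℂ V}
    (hT : T ∈ Algebra.adjoin ℂ (Set.range fun Y : G.compactLie => ρ𝔤 (LieSubalgebra.inclusion G.compactLie_le_lie Y)))
    {w w' : W} (hw : j₀ w' = T (j₀ w)) : j w' = T (j w) := by
  -- stability of `j₀(W)` under the `𝔨`-algebra (§1)
  have hstab : ∀ {S : Module.End ℂ V},
      S ∈ Algebra.adjoin ℂ (Set.range fun Y : G.compactLie => ρ𝔤 (LieSubalgebra.inclusion G.compactLie_le_lie Y)) →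
      ∀ x : W, ∃ y : W, j₀ y = S (j₀ x) := fun hS x => by
    obtain ⟨y, hy⟩ := h.apply_mem_of_K_stable_of_mem_adjoin (range_K_stable j₀) hS
      (LinearMap.mem_range_self j₀.toLinearMap x)
    exact ⟨y, hy⟩
  induction hT using Algebra.adjoin_induction generalizing w w' with
  | mem T hT =>
    obtain ⟨Y, rfl⟩ := hT
    exact IntertwiningMap.apply_eq_of_apply_eq_lie h j₀ j hj₀ Y hw
  | algebraMap r =>
    rw [Algebra.algebraMap_eq_smul_one, LinearMap.smul_apply, Module.End.one_apply] at hw ⊢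
    rw [← map_smul] at hw
    rw [hj₀ hw, map_smul]
  | add S T hS hT ihS ihT =>
    obtain ⟨y₁, hy₁⟩ := hstab hS w
    obtain ⟨y₂, hy₂⟩ := hstab hT w
    have hw' : w' = y₁ + y₂ := hj₀ (by rw [hw, map_add, hy₁, hy₂, LinearMap.add_apply])
    rw [hw', map_add, ihS hy₁, ihT hy₂, LinearMap.add_apply]
  | mul S T hS hT ihS ihT =>
    obtain ⟨y₂, hy₂⟩ := hstab hT w
    obtain ⟨y₃, hy₃⟩ := hstab hS y₂
    have hw' : w' = y₃ := hj₀ (by rw [hw, Module.End.mul_apply, ← hy₂, hy₃])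
    rw [hw', ihS hy₃, ihT hy₂, Module.End.mul_apply]

end Transport

/-! ## §3 Kernels of `∏ (T − c)` -/

section Kernel

variable (T : Module.End ℂ V)

/-- `∏_{c ∈ s} (T − c)` vanishes on `⨆_{c ∈ s} ker (T − c)`. [cite: KnappVogan1995, §I.3 (before Prop. 1.63)] -/
theorem aeval_prod_X_sub_C_eq_zero_of_mem (s : Finset ℂ) {v : V} (hv : v ∈ ⨆ c ∈ s, Module.End.eigenspace T c) :
    aeval T (∏ c ∈ s, (X - C c)) v = 0 := by
  suffices H : (⨆ c ∈ s, Module.End.eigenspace T c) ≤ LinearMap.ker (aeval T (∏ c ∈ s, (X - C c))) from H hv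
  refine iSup₂_le fun c hc v hv => ?_
  rw [LinearMap.mem_ker, ← Finset.prod_erase_mul s _ hc, map_mul, Module.End.mul_apply, map_sub, aeval_X, aeval_C,
    LinearMap.sub_apply, Algebra.algebraMap_eq_smul_one, LinearMap.smul_apply, Module.End.one_apply,
    (Module.End.mem_eigenspace_iff.1 hv), sub_self, map_zero]

/-- `ker ∏_{c ∈ s} (T − c) ≤ ⨆_{c ∈ s} ker (T − c)` (the factors are pairwise coprime). [cite: KnappVogan1995, §I.3 (before Prop. 1.63)] -/
theorem ker_aeval_prod_X_sub_C_le (s : Finset ℂ) :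
    LinearMap.ker (aeval T (∏ c ∈ s, (X - C c))) ≤ ⨆ c ∈ s, Module.End.eigenspace T c := by
  classical
  induction s using Finset.induction_on with
  | empty =>
    intro v hv
    rw [Finset.prod_empty, map_one, LinearMap.mem_ker, Module.End.one_apply] at hv
    rw [hv]
    exact Submodule.zero_mem _
  | insert a s ha ih =>
    have hcop : IsCoprime (X - C a) (∏ c ∈ s, (X - C c)) :=
      IsCoprime.prod_right fun c hc => pairwise_coprime_X_sub_C (s := fun z : ℂ => z) (fun _ _ h => h)
        (fun h => ha (h ▸ hc))
    rw [Finset.prod_insert ha, ← sup_ker_aeval_eq_ker_aeval_mul_of_coprime T hcop, Finset.iSup_insert]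
    refine sup_le_sup ?_ ih
    intro v hv
    rw [LinearMap.mem_ker, map_sub, aeval_X, aeval_C, LinearMap.sub_apply, Algebra.algebraMap_eq_smul_one,
      LinearMap.smul_apply, Module.End.one_apply, sub_eq_zero] at hv
    exact Module.End.mem_eigenspace_iff.2 hv

end Kernel

/-! ## §4 The admissibility criterion -/

/-- **Admissibility from a diagonalisable element of the `𝔨`-algebra with finite-dimensional eigenspaces.**  Let `(ρK, ρ𝔤)`
be a `(𝔤, K)`-module and `T` an element of the subalgebra of `End V` generated by `ρ𝔤(𝔨)` such that every vector is a finite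
sum of `T`-eigenvectors and every eigenspace of `T` is finite-dimensional.  Then `ρK` is admissible: every irreducible
finite-dimensional `K`-module `τ` has `dim Hom_K(τ, V) < ∞`.  Proof: if some `K`-map `j₀ ≠ 0` exists it is injective, `j₀(W)`
lies in `E = ⨆_{c ∈ C₀} ker (T − c)` for a finite `C₀`, so `∏_{c ∈ C₀} (T − c)` kills `j₀(W)`, hence (transport lemma, §2) every
`j(W)`, so every `K`-map factors through the finite-dimensional `E` (§3) and `Hom_K(τ, V) ↪ Hom_ℂ(W, E)`.
[cite: KnappVogan1995, §I.3 (before Prop. 1.63)] [cite: BorelWallach2000, 0 §2.4] -/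
theorem isAdmissibleGK_of_mem_adjoin_of_eigenspaces (h : IsGKModule G ρK ρ𝔤) {T : Module.End ℂ V}
    (hT : T ∈ Algebra.adjoin ℂ (Set.range fun Y : G.compactLie => ρ𝔤 (LieSubalgebra.inclusion G.compactLie_le_lie Y)))
    (hdiag : ∀ v : V, ∃ s : Finset ℂ, v ∈ ⨆ c ∈ s, Module.End.eigenspace T c)
    (hfin : ∀ c : ℂ, FiniteDimensional ℂ (Module.End.eigenspace T c)) : IsAdmissibleGK ρK := by
  classical
  intro W _ _ _ τ hτ
  haveI := hτ
  by_cases h0 : ∀ j : τ.IntertwiningMap ρK, j = 0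
  · haveI : Subsingleton (τ.IntertwiningMap ρK) := ⟨fun a b => by rw [h0 a, h0 b]⟩
    infer_instance
  push Not at h0
  obtain ⟨j₀, hj₀⟩ := h0
  have hinj : Function.Injective j₀ := (Representation.IsIrreducible.injective_or_eq_zero j₀).resolve_right hj₀
  -- a finite set `C₀` of eigenvalues with `j₀(W) ⊆ E := ⨆_{c ∈ C₀} ker (T − c)`
  obtain ⟨C₀, hC₀⟩ : ∃ C₀ : Finset ℂ, ∀ w : W, j₀ w ∈ ⨆ c ∈ C₀, Module.End.eigenspace T c := by
    let b := Module.finBasis ℂ W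
    choose s hs using fun i => hdiag (j₀ (b i))
    refine ⟨Finset.univ.biUnion s, fun w => ?_⟩
    rw [← b.sum_repr w, map_sum]
    refine Submodule.sum_mem _ fun i _ => ?_
    rw [map_smul]
    refine Submodule.smul_mem _ _ ?_
    have hle : (⨆ c ∈ s i, Module.End.eigenspace T c) ≤ ⨆ c ∈ Finset.univ.biUnion s, Module.End.eigenspace T c :=
      biSup_mono fun c hc => Finset.mem_biUnion.2 ⟨i, Finset.mem_univ _, hc⟩
    exact hle (hs i)
  set E : Submodule ℂ V := ⨆ c ∈ C₀, Module.End.eigenspace T c with hE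
  haveI : FiniteDimensional ℂ E := by
    rw [hE, ← Finset.sup_eq_iSup]
    infer_instance
  -- `p(T) = ∏_{c ∈ C₀} (T − c)` lies in the `𝔨`-algebra and kills `E`
  have hpT : aeval T (∏ c ∈ C₀, (X - C c)) ∈
      Algebra.adjoin ℂ (Set.range fun Y : G.compactLie => ρ𝔤 (LieSubalgebra.inclusion G.compactLie_le_lie Y)) :=
    Algebra.adjoin_singleton_le hT (aeval_mem_adjoin_singleton ℂ T)
  -- every `K`-map lands in `E`
  have hrange : ∀ (j : τ.IntertwiningMap ρK) (w : W), j w ∈ E := by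
    intro j w
    refine ker_aeval_prod_X_sub_C_le T C₀ ?_
    rw [LinearMap.mem_ker]
    have key := IntertwiningMap.apply_eq_of_apply_eq_of_mem_adjoin h j₀ j hinj hpT (w := w) (w' := 0)
      (by rw [map_zero, aeval_prod_X_sub_C_eq_zero_of_mem T C₀ (hC₀ w)])
    rw [map_zero] at key
    exact key.symm
  -- `Hom_K(τ, V) ↪ Hom_ℂ(W, E)`
  let Φ : τ.IntertwiningMap ρK →ₗ[ℂ] (W →ₗ[ℂ] E) :=
    { toFun := fun j => LinearMap.codRestrict E j.toLinearMap (hrange j)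
      map_add' := fun _ _ => LinearMap.ext fun _ => Subtype.ext rfl
      map_smul' := fun _ _ => LinearMap.ext fun _ => Subtype.ext rfl }
  refine Module.Finite.of_injective Φ fun j j' hjj' => ?_
  refine Representation.IntertwiningMap.ext (LinearMap.ext fun w => ?_)
  exact congrArg Subtype.val (LinearMap.congr_fun hjj' w)

/-- **Admissibility from a diagonalisable element of `𝔨` with finite-dimensional eigenspaces**: if for some `Z ∈ 𝔨` the
operator `ρ𝔤 Z` is diagonalisable on `V` with finite-dimensional eigenspaces, then every compatible `K`-action `ρK` is
admissible (`isAdmissibleGK_of_mem_adjoin_of_eigenspaces` with `T = ρ𝔤 Z`). [cite: KnappVogan1995, §I.3 (before Prop. 1.63)] [cite: BorelWallach2000, 0 §2.4] -/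
theorem isAdmissibleGK_of_eigenspaces (h : IsGKModule G ρK ρ𝔤) (Z : G.compactLie)
    (hdiag : ∀ v : V, ∃ s : Finset ℂ, v ∈ ⨆ c ∈ s,
      Module.End.eigenspace (ρ𝔤 (LieSubalgebra.inclusion G.compactLie_le_lie Z)) c)
    (hfin : ∀ c : ℂ, FiniteDimensional ℂ
      (Module.End.eigenspace (ρ𝔤 (LieSubalgebra.inclusion G.compactLie_le_lie Z)) c)) : IsAdmissibleGK ρK :=
  h.isAdmissibleGK_of_mem_adjoin_of_eigenspaces (Algebra.subset_adjoin ⟨Z, rfl⟩) hdiag hfin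

/-! ## §5 The criterion from an eigenbasis with finite fibres -/

/-- **Admissibility from an eigenbasis with finite fibres.**  If `V` has a basis `b` of eigenvectors of some `T` in the
`𝔨`-algebra, `T (b i) = c i • b i`, and each eigenvalue is taken by only finitely many basis vectors, then every compatible
`K`-action is admissible (the eigenspace `ker (T − c₀)` is spanned by the `b i` with `c i = c₀`). This is the shape of explicit
`K`-type data («each weight occurs finitely often»). [cite: KnappVogan1995, §I.3 (before Prop. 1.63)] [cite: BorelWallach2000, 0 §2.4] -/
theorem isAdmissibleGK_of_basis_eigenvector (h : IsGKModule G ρK ρ𝔤) {T : Module.End ℂ V}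
    (hT : T ∈ Algebra.adjoin ℂ (Set.range fun Y : G.compactLie => ρ𝔤 (LieSubalgebra.inclusion G.compactLie_le_lie Y)))
    {ι : Type*} (b : Basis ι ℂ V) (c : ι → ℂ) (hb : ∀ i, T (b i) = c i • b i)
    (hfib : ∀ c₀ : ℂ, Set.Finite {i | c i = c₀}) : IsAdmissibleGK ρK := by
  classical
  refine h.isAdmissibleGK_of_mem_adjoin_of_eigenspaces hT (fun v => ?_) (fun c₀ => ?_)
  · -- `v = Σ_{i ∈ supp} v_i • b i`, `b i ∈ ker (T − c i)`
    set S : Finset ℂ := (b.repr v).support.image c with hS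
    refine ⟨S, ?_⟩
    have hv := b.linearCombination_repr v
    rw [Finsupp.linearCombination_apply, Finsupp.sum] at hv
    rw [← hv]
    refine Submodule.sum_mem _ fun i hi => Submodule.smul_mem _ _ ?_
    have hi' : b i ∈ Module.End.eigenspace T (c i) := Module.End.mem_eigenspace_iff.2 (hb i)
    have hci : c i ∈ S := hS ▸ Finset.mem_image_of_mem c hi
    exact (le_biSup (fun c => Module.End.eigenspace T c) hci) hi'
  · -- `ker (T − c₀) ≤ span {b i | c i = c₀}`, finite-dimensional
    have hle : Module.End.eigenspace T c₀ ≤ Submodule.span ℂ (b '' {i | c i = c₀}) := by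
      intro v hv
      rw [Module.End.mem_eigenspace_iff] at hv
      -- coordinates: `(c i − c₀) · v_i = 0`
      have hTv : T v = ∑ k ∈ (b.repr v).support, ((b.repr v) k * c k) • b k := by
        conv_lhs => rw [← b.linearCombination_repr v]
        rw [Finsupp.linearCombination_apply, Finsupp.sum, map_sum]
        refine Finset.sum_congr rfl fun k _ => ?_
        rw [map_smul, hb, smul_smul]
      have hcoord : ∀ i, (b.repr v) i ≠ 0 → c i = c₀ := by
        intro i hi
        have h1 : b.repr (T v) i = (b.repr v) i * c i := by
          rw [hTv, map_sum, Finsupp.finsetSum_apply, Finset.sum_eq_single i]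
          · rw [map_smul, Basis.repr_self, Finsupp.smul_apply, Finsupp.single_eq_same, smul_eq_mul, mul_one]
          · intro k _ hki
            rw [map_smul, Basis.repr_self, Finsupp.smul_apply, Finsupp.single_apply, if_neg hki, smul_zero]
          · intro hi'
            rw [Finsupp.notMem_support_iff.1 hi', zero_mul, zero_smul, map_zero, Finsupp.zero_apply]
        have h2 : b.repr (T v) i = c₀ * (b.repr v) i := by
          rw [hv, map_smul, Finsupp.smul_apply, smul_eq_mul]
        have h3 : (c i - c₀) * (b.repr v) i = 0 := by linear_combination (-1 : ℂ) * h1 + h2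
        exact sub_eq_zero.1 ((mul_eq_zero.1 h3).resolve_right hi)
      rw [← b.linearCombination_repr v, Finsupp.linearCombination_apply, Finsupp.sum]
      refine Submodule.sum_mem _ fun i hi => Submodule.smul_mem _ _ (Submodule.subset_span ⟨i, ?_, rfl⟩)
      exact hcoord i (Finsupp.mem_support_iff.1 hi)
    haveI : FiniteDimensional ℂ (Submodule.span ℂ (b '' {i | c i = c₀})) :=
      FiniteDimensional.span_of_finite ℂ ((hfib c₀).image b)
    exact Submodule.finiteDimensional_of_le hle

end IsGKModule

end Literature.NumberTheory.Automorphic
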